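import Summits.AtomisticToContinuum.HydrodynamicLimit.Theses.JParityClosure
import Literature.MathematicalPhysics.KineticTheory.HardSphereCampbellAssembly
import Literature.MathematicalPhysics.KineticTheory.HardSphereEulerProofs
import Literature.Analysis.FluidPDE.HardSphereTorusMeasure
import Mathlib.MeasureTheory.Integral.Marginal
import HarnessLib

/-!
# Flux ≤ 2 × local-Gibbs expectation of the insertion integrand (F1 of P4)

Crux `JParityClosure.OddContactSymmetry` (stmt-AtomisticToContinuum-17722), line `KineticSlabSketch`,
registered stub `stub_fluxLeGibbs`: the Gibbs-weighted outgoing contact flux of a mark `f ≥ 0` is at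
most twice the local-Gibbs expectation of the insertion integrand
`z ↦ ∫ dω ε² (ω·(vᵢ−vⱼ))₊ f(zⁱʲ_ω, i, j)` (rung 0: constant profiles `a ≡ 1`, `u ≡ 0`, `θ`).

Proof: termwise in the ordered pair `i ≠ j` and the direction `ω`. The canonical density at the
inserted configuration `zⁱʲ_ω` has the same Maxwellian factor as at `z` (velocities are kept) and its
hard-core indicator is dominated by the indicator of the constraints NOT involving `i`; the resulting
integrand does not depend on the position `xᵢ`, which is integrated out (Tonelli over one coordinate
of the product phase space); re-inserting the constraints of `i` costs the FREE VOLUME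
`vol{x | dist(x, x_k) ≥ ε ∀ k ≠ i} ≥ 1 − N |B_ε| ≥ 1/2` for `σ ≤ 1/4` (`N ε³ ≤ σ³ ≤ 1/64`).
-/

noncomputable section

open scoped BigOperators Classical InnerProductSpace ENNReal Topology
open Set MeasureTheory Filter
open Literature.Analysis.FluidPDE Literature.MathematicalPhysics.KineticTheory

namespace Summit.AtomisticToContinuum.HydrodynamicLimit.Theorems.OddContactSymmetryKineticSlab

/-! ### Integrating out one coordinate of a finite product -/

/-- Comparison of two integrals over a finite power of a σ-finite measure through the innermost
integral over one coordinate: if for every frozen configuration `x` the integral of `F` over the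
`i`-th coordinate is at most that of `G`, then `∫ F ≤ ∫ G` (Tonelli, `lmarginal_erase'`). [folklore] -/
theorem lintegral_pi_le_of_update_le {α : Type*} [MeasurableSpace α] (μ : Measure α) [SigmaFinite μ]
    {n : ℕ} (i : Fin n) (x₀ : Fin n → α) {F G : (Fin n → α) → ℝ≥0∞} (hF : Measurable F)
    (hG : Measurable G)
    (h : ∀ x, ∫⁻ y, F (Function.update x i y) ∂μ ≤ ∫⁻ y, G (Function.update x i y) ∂μ) :
    ∫⁻ x, F x ∂Measure.pi (fun _ => μ) ≤ ∫⁻ x, G x ∂Measure.pi (fun _ => μ) := by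
  rw [lintegral_eq_lmarginal_univ x₀, lintegral_eq_lmarginal_univ x₀,
    lmarginal_erase' F hF (Finset.mem_univ i), lmarginal_erase' G hG (Finset.mem_univ i)]
  exact lmarginal_mono (fun x => h x) x₀

/-! ### Free volume of one sphere among `N` others on `𝕋³` -/

/-- **Free volume.** If `N |B_ε| ≤ 1/2` (`ε < 1/2`), the set of points of `𝕋³` at minimal-image
distance `≥ ε` from the `N` centres `x_k`, `k ≠ i`, has Haar measure `≥ 1/2`. [folklore] -/
theorem one_le_two_mul_volume_clear {N : ℕ} (i : Fin (N + 1)) (x : Fin (N + 1) → T3 × V3) {ε : ℝ}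
    (hε : ε < 1 / 2) (hsmall : (N : ℝ≥0∞) * volume (Metric.ball (0 : V3) ε) ≤ 2⁻¹) :
    1 ≤ 2 * volume {q : T3 | ∀ k, k ≠ i → ε ≤ ‖(Torus.geometry (Fin 3)).sepVec q (x k).1‖} := by
  set S : Set T3 := {q : T3 | ∀ k, k ≠ i → ε ≤ ‖(Torus.geometry (Fin 3)).sepVec q (x k).1‖} with hS
  -- the complement is covered by the `N` minimal-image balls around the other centres
  have hcover : Sᶜ ⊆ ⋃ k ∈ (Finset.univ : Finset (Fin (N + 1))).erase i,
      {q : T3 | Torus.euclidDist q (x k).1 < ε} := by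
    intro q hq
    simp only [hS, mem_compl_iff, mem_setOf_eq, not_forall, not_le, exists_prop] at hq
    obtain ⟨k, hk, hlt⟩ := hq
    exact mem_biUnion (Finset.mem_erase.2 ⟨hk, Finset.mem_univ k⟩) hlt
  have hcompl : volume Sᶜ ≤ 2⁻¹ := by
    refine (measure_mono hcover).trans ((measure_biUnion_finset_le _ _).trans ?_)
    simp only [Torus.volume_euclidDist_lt hε, Finset.sum_const, Finset.card_erase_of_mem
      (Finset.mem_univ i), Finset.card_univ, Fintype.card_fin, Nat.add_sub_cancel, nsmul_eq_mul]
    exact hsmall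
  have hone : (1 : ℝ≥0∞) ≤ volume S + 2⁻¹ := by
    calc (1 : ℝ≥0∞) = volume (univ : Set T3) := measure_univ.symm
      _ = volume (S ∪ Sᶜ) := by rw [union_compl_self]
      _ ≤ volume S + volume Sᶜ := measure_union_le _ _
      _ ≤ volume S + 2⁻¹ := add_le_add le_rfl hcompl
  have hhalf : (2⁻¹ : ℝ≥0∞) ≤ volume S := by
    rw [← ENNReal.inv_two_add_inv_two] at hone
    exact (ENNReal.add_le_add_iff_right (by simp)).1 hone
  calc (1 : ℝ≥0∞) = 2 * 2⁻¹ := (ENNReal.mul_inv_cancel two_ne_zero ENNReal.ofNat_ne_top).symm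
    _ ≤ 2 * volume S := mul_le_mul' le_rfl hhalf

/-- **Integrating out the position of one particle.** For a measurable `H ≥ 0` on the phase space of
`N + 1` particles which does not depend on the position of particle `i`, re-inserting the indicator
that `xᵢ` is `ε`-clear of the other centres costs at most a factor `2` once `N |B_ε| ≤ 1/2`:
`∫ H ≤ 2 ∫ 𝟙{∀ k ≠ i, dist(xᵢ, x_k) ≥ ε} H`. [folklore] -/
theorem lintegral_le_two_mul_lintegral_indicator_clear {N : ℕ} (i : Fin (N + 1)) {ε : ℝ}
    (hε : ε < 1 / 2) (hsmall : (N : ℝ≥0∞) * volume (Metric.ball (0 : V3) ε) ≤ 2⁻¹)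
    {H : Config (N + 1) (Fin 3) T3 → ℝ≥0∞} (hH : Measurable H)
    (hHi : ∀ z q, H (Function.update z i (q, (z i).2)) = H z) :
    ∫⁻ z, H z ≤ 2 * ∫⁻ z, {z : Config (N + 1) (Fin 3) T3 |
      ∀ k, k ≠ i → ε ≤ ‖(Torus.geometry (Fin 3)).sepVec (z i).1 (z k).1‖}.indicator H z := by
  haveI hXE : SigmaFinite (volume : Measure (T3 × V3)) := inferInstance
  set C : Set (Config (N + 1) (Fin 3) T3) := {z | ∀ k, k ≠ i →
    ε ≤ ‖(Torus.geometry (Fin 3)).sepVec (z i).1 (z k).1‖} with hCdef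
  have hsep : ∀ k l : Fin (N + 1), Measurable fun z : Config (N + 1) (Fin 3) T3 =>
      ‖(Torus.geometry (Fin 3)).sepVec (z k).1 (z l).1‖ := fun k l =>
    (Torus.measurable_geometry_sepVec.comp
      ((measurable_pi_apply k).fst.prodMk (measurable_pi_apply l).fst)).norm
  have hC : MeasurableSet C := by
    refine measurableSet_setOf.2 (Measurable.forall fun k => measurable_const.imp ?_)
    exact measurableSet_setOf.1 (measurableSet_le measurable_const (hsep i k))
  rw [← lintegral_const_mul _ (hH.indicator hC)]
  refine lintegral_pi_le_of_update_le (volume : Measure (T3 × V3)) i (fun _ => ((0 : T3), (0 : V3)))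
    hH (measurable_const.mul (hH.indicator hC)) fun x => ?_
  -- freeze the other particles and the velocity of `i`; integrate its position first
  have hmu : Measurable (Function.update x i : T3 × V3 → Config (N + 1) (Fin 3) T3) :=
    measurable_update x
  rw [show (volume : Measure (T3 × V3)) = (volume : Measure T3).prod (volume : Measure V3) from rfl,
    lintegral_prod_symm (fun y => H (Function.update x i y)) (hH.comp hmu).aemeasurable,
    lintegral_prod_symm (fun y => 2 * C.indicator H (Function.update x i y))
      ((measurable_const.mul (hH.indicator hC)).comp hmu).aemeasurable]
  refine lintegral_mono fun u => ?_
  -- the frozen integrand is constant in the position `q` of particle `i`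
  set A : ℝ≥0∞ := H (Function.update x i ((x i).1, u)) with hA
  have hconst : ∀ q : T3, H (Function.update x i (q, u)) = A := by
    intro q
    have h := hHi (Function.update x i (q, u)) (x i).1
    simp only [Function.update_self, Function.update_idem] at h
    rw [hA, ← h]
  set S : Set T3 := {q : T3 | ∀ k, k ≠ i → ε ≤ ‖(Torus.geometry (Fin 3)).sepVec q (x k).1‖} with hSdef
  have hS : MeasurableSet S := by
    refine measurableSet_setOf.2 (Measurable.forall fun k => measurable_const.imp ?_)
    exact measurableSet_setOf.1 (measurableSet_le measurable_const
      ((Torus.measurable_geometry_sepVec.comp (measurable_id.prodMk measurable_const)).norm))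
  have hind : ∀ q : T3, C.indicator H (Function.update x i (q, u)) = S.indicator (fun _ => A) q := by
    intro q
    have hmem : Function.update x i (q, u) ∈ C ↔ q ∈ S := by
      simp only [hCdef, hSdef, mem_setOf_eq, Function.update_self]
      refine forall_congr' fun k => imp_congr_right fun hk => ?_
      rw [Function.update_of_ne hk]
    by_cases hq : q ∈ S
    · rw [indicator_of_mem (hmem.2 hq), indicator_of_mem hq, hconst q]
    · rw [indicator_of_notMem (fun h => hq (hmem.1 h)), indicator_of_notMem hq]
  simp_rw [hconst, hind]
  rw [lintegral_const, measure_univ, mul_one, lintegral_const_mul _ (measurable_const.indicator hS),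
    lintegral_indicator_const hS]
  calc A = A * 1 := (mul_one A).symm
    _ ≤ A * (2 * volume S) := mul_le_mul' le_rfl (one_le_two_mul_volume_clear i x hε hsmall)
    _ = 2 * (A * volume S) := by ring

/-- **Smallness at `σ ≤ 1/4`.** `N |B_{ε_N}| ≤ 1/2` for `ε_N = σ (N+1)^{-1/3}`:
`N ε_N³ (4π/3) ≤ σ³ · 16/3 ≤ 1/12`. [folklore] -/
theorem natCast_mul_volume_ball_hsDiameter_le {σ : ℝ} (hσ : 0 < σ) (hσ4 : σ ≤ 1 / 4) (N : ℕ) :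
    (N : ℝ≥0∞) * volume (Metric.ball (0 : V3) (hsDiameter σ N)) ≤ 2⁻¹ := by
  have hε0 : 0 ≤ hsDiameter σ N := (hsDiameter_pos hσ N).le
  have h3 := succ_mul_hsDiameter_pow_three σ N
  have hσ3 : σ ^ 3 ≤ (1 / 4) ^ 3 := pow_le_pow_left₀ hσ.le hσ4 3
  have hN : (N : ℝ) * hsDiameter σ N ^ 3 ≤ σ ^ 3 := by
    rw [← h3]
    exact mul_le_mul_of_nonneg_right (by exact_mod_cast N.le_succ) (pow_nonneg hε0 3)
  have hreal : (N : ℝ) * (hsDiameter σ N ^ 3 * (Real.pi * 4 / 3)) ≤ 1 / 2 := by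
    have hπ := Real.pi_le_four
    have hπ0 := Real.pi_pos.le
    nlinarith [mul_nonneg (Nat.cast_nonneg N) (pow_nonneg hε0 3)]
  rw [EuclideanSpace.volume_ball_fin_three, ← ENNReal.ofReal_pow hε0, ← ENNReal.ofReal_mul (pow_nonneg hε0 3),
    ← ENNReal.ofReal_natCast, ← ENNReal.ofReal_mul (Nat.cast_nonneg N),
    show (2⁻¹ : ℝ≥0∞) = ENNReal.ofReal (1 / 2) by
      rw [ENNReal.ofReal_div_of_pos two_pos, ENNReal.ofReal_one, ENNReal.ofReal_ofNat, one_div]]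
  exact ENNReal.ofReal_le_ofReal hreal

/-! ### The rung-0 canonical density at an inserted configuration -/

/-- The tensor power of the rung-0 profile `(x, v) ↦ M_θ(v)` only depends on the velocities.
[folklore] -/
theorem tensorPow_rung0_eq_of_vel_eq (θ : ℝ) {n : ℕ} {z z' : Config n (Fin 3) T3}
    (h : ∀ k, (z' k).2 = (z k).2) :
    tensorPow n (localGibbsProfile (fun _ => 1) (fun _ => 0) (fun _ => θ)) z' =
      tensorPow n (localGibbsProfile (fun _ => 1) (fun _ => 0) (fun _ => θ)) z := by
  simp only [tensorPow, localGibbsProfile, h]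

/-- **Pointwise domination at the inserted configuration.** At `w = zⁱʲ_ω` (particle `i` re-placed at
contact with `j`, velocities kept) the hard-core-restricted canonical weight `𝟙_D(w) Z⁻¹ 𝟙_D(w) M(w)`
is at most `Z⁻¹ 𝟙_{D⁽ⁱ⁾}(z) M(z)`, `D⁽ⁱ⁾` the constraints not involving `i` (`w = z` off `i`, and the
Maxwellian factor only sees the velocities). [folklore] -/
theorem fluxIntegrand_le {θ : ℝ} (hθ : 0 < θ) (ε : ℝ) {N : ℕ}
    (f : Config (N + 1) (Fin 3) T3 → Fin (N + 1) → Fin (N + 1) → ℝ≥0∞) (i j : Fin (N + 1)) (ω : V3)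
    (z : Config (N + 1) (Fin 3) T3) (Kv : ℝ≥0∞) :
    Kv * (hardSphereDomain (Torus.geometry (Fin 3)) (N + 1) ε).indicator
          (fun w => ENNReal.ofReal (canonicalDensity (Torus.geometry (Fin 3)) ε (N + 1)
            (localGibbsProfile (fun _ => 1) (fun _ => 0) (fun _ => θ)) w) * f w i j)
          (contactInsert ε i j ω z) ≤
      ENNReal.ofReal ((canonicalPartition (Torus.geometry (Fin 3)) ε (N + 1)
            (localGibbsProfile (fun _ => 1) (fun _ => 0) (fun _ => θ)))⁻¹ *
          {z : Config (N + 1) (Fin 3) T3 | ∀ k l, k ≠ l → k ≠ i → l ≠ i →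
            ε ≤ ‖(Torus.geometry (Fin 3)).sepVec (z k).1 (z l).1‖}.indicator
            (tensorPow (N + 1) (localGibbsProfile (fun _ => 1) (fun _ => 0) (fun _ => θ))) z) *
        (Kv * f (contactInsert ε i j ω z) i j) := by
  set D := hardSphereDomain (Torus.geometry (Fin 3)) (N + 1) ε with hD
  set f₀ : T3 × V3 → ℝ := localGibbsProfile (fun _ => 1) (fun _ => 0) (fun _ => θ) with hf₀
  set Zc : ℝ := canonicalPartition (Torus.geometry (Fin 3)) ε (N + 1) f₀ with hZc
  set M : Config (N + 1) (Fin 3) T3 → ℝ := tensorPow (N + 1) f₀ with hM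
  set Di : Set (Config (N + 1) (Fin 3) T3) := {z | ∀ k l, k ≠ l → k ≠ i → l ≠ i →
    ε ≤ ‖(Torus.geometry (Fin 3)).sepVec (z k).1 (z l).1‖} with hDi
  have hf₀nn : ∀ y, 0 ≤ f₀ y := fun y =>
    localGibbsProfile_nonneg (a₀ := fun _ => 1) (u₀ := fun _ => 0) (θ₀ := fun _ => θ)
      (fun _ => zero_le_one) (fun _ => hθ.le) y
  have hZc0 : 0 ≤ Zc⁻¹ := inv_nonneg.2 (canonicalPartition_nonneg _ _ _ fun y => hf₀nn y)
  have hM0 : ∀ z, 0 ≤ M z := fun z => tensorPow_nonneg (fun y => hf₀nn y) (N + 1) z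
  have hρ : ∀ z, canonicalDensity (Torus.geometry (Fin 3)) ε (N + 1) f₀ z = Zc⁻¹ * D.indicator M z :=
    fun z => rfl
  -- the weight at the inserted configuration
  have hle : ENNReal.ofReal (canonicalDensity (Torus.geometry (Fin 3)) ε (N + 1) f₀ (contactInsert ε i j ω z)) ≤
      ENNReal.ofReal (Zc⁻¹ * Di.indicator M z) := by
    rw [hρ]
    refine ENNReal.ofReal_le_ofReal (mul_le_mul_of_nonneg_left ?_ hZc0)
    by_cases hwD : contactInsert ε i j ω z ∈ D
    · have hzDi : z ∈ Di := fun k l hkl hki hli => by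
        have h := hwD k l hkl
        rwa [contactInsert_apply_of_ne ε j ω z hki, contactInsert_apply_of_ne ε j ω z hli] at h
      rw [indicator_of_mem hwD, indicator_of_mem hzDi]
      exact (tensorPow_rung0_eq_of_vel_eq θ (contactInsert_vel ε i j ω z)).le
    · rw [indicator_of_notMem hwD]
      exact indicator_nonneg (fun y _ => hM0 y) z
  calc Kv * D.indicator (fun w => ENNReal.ofReal (canonicalDensity (Torus.geometry (Fin 3)) ε (N + 1) f₀ w) *
          f w i j) (contactInsert ε i j ω z)
      ≤ Kv * (ENNReal.ofReal (canonicalDensity (Torus.geometry (Fin 3)) ε (N + 1) f₀ (contactInsert ε i j ω z)) *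
          f (contactInsert ε i j ω z) i j) := mul_le_mul' le_rfl (indicator_le_self _ _ _)
    _ = ENNReal.ofReal (canonicalDensity (Torus.geometry (Fin 3)) ε (N + 1) f₀ (contactInsert ε i j ω z)) *
          (Kv * f (contactInsert ε i j ω z) i j) := by ring
    _ ≤ _ := mul_le_mul' hle le_rfl

/-! ### The bound for one ordered pair, and the assembly -/

/-- **One ordered pair.** For `i ≠ j`, the `(i, j)` term of the Gibbs-weighted outgoing flux is at most
twice the local-Gibbs expectation of the insertion integral: dominate the weight at the inserted
configuration (`fluxIntegrand_le`), integrate out the position of `i`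
(`lintegral_le_two_mul_lintegral_indicator_clear`, free volume `≥ 1/2` at `σ ≤ 1/4`), and re-insert the
constraints of `i` inside the canonical density. [folklore] -/
theorem fluxTerm_le {σ : ℝ} (hσ : 0 < σ) (hσ4 : σ ≤ 1 / 4) {θ : ℝ} (hθ : 0 < θ) (N : ℕ)
    {f : Config (N + 1) (Fin 3) T3 → Fin (N + 1) → Fin (N + 1) → ℝ≥0∞}
    (hf : ∀ i j, Measurable fun w => f w i j) {i j : Fin (N + 1)} (hij : i ≠ j) :
    ∫⁻ z, ∫⁻ ω : Metric.sphere (0 : V3) 1,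
        ENNReal.ofReal (hsDiameter σ N ^ 2 * ⟪((ω : V3)), (z i).2 - (z j).2⟫_ℝ) *
          (hardSphereDomain (Torus.geometry (Fin 3)) (N + 1) (hsDiameter σ N)).indicator
            (fun w => ENNReal.ofReal (canonicalDensity (Torus.geometry (Fin 3)) (hsDiameter σ N) (N + 1)
              (localGibbsProfile (fun _ => 1) (fun _ => 0) (fun _ => θ)) w) * f w i j)
            (contactInsert (hsDiameter σ N) i j (ω : V3) z)
        ∂(volume : Measure V3).toSphere ≤
      2 * ∫⁻ z, ∫⁻ ω : Metric.sphere (0 : V3) 1,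
            ENNReal.ofReal (hsDiameter σ N ^ 2 * ⟪((ω : V3)), (z i).2 - (z j).2⟫_ℝ) *
              f (contactInsert (hsDiameter σ N) i j (ω : V3) z) i j
          ∂(volume : Measure V3).toSphere
        ∂(localGibbsMeasure σ (fun _ => 1) (fun _ => 0) (fun _ => θ) N) := by
  haveI hSF : SFinite ((volume : Measure V3).toSphere) := inferInstance
  have hρm : Measurable fun z : Config (N + 1) (Fin 3) T3 => ENNReal.ofReal
      (canonicalDensity (Torus.geometry (Fin 3)) (hsDiameter σ N) (N + 1)
        (localGibbsProfile (fun _ => 1) (fun _ => 0) (fun _ => θ)) z) :=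
    (measurable_canonicalDensity _ _
      (measurable_localGibbsProfile continuous_const continuous_const continuous_const)).ennreal_ofReal
  rw [localGibbsMeasure, lintegral_withDensity_eq_lintegral_mul_non_measurable _ hρm
    (ae_of_all _ fun _ => ENNReal.ofReal_lt_top)]
  -- names
  set ε := hsDiameter σ N with hε
  set D := hardSphereDomain (Torus.geometry (Fin 3)) (N + 1) ε with hD
  set f₀ : T3 × V3 → ℝ := localGibbsProfile (fun _ => 1) (fun _ => 0) (fun _ => θ) with hf₀
  set Zc : ℝ := canonicalPartition (Torus.geometry (Fin 3)) ε (N + 1) f₀ with hZc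
  set M : Config (N + 1) (Fin 3) T3 → ℝ := tensorPow (N + 1) f₀ with hM
  set Di : Set (Config (N + 1) (Fin 3) T3) := {z | ∀ k l, k ≠ l → k ≠ i → l ≠ i →
    ε ≤ ‖(Torus.geometry (Fin 3)).sepVec (z k).1 (z l).1‖} with hDi
  set C : Set (Config (N + 1) (Fin 3) T3) := {z | ∀ k, k ≠ i →
    ε ≤ ‖(Torus.geometry (Fin 3)).sepVec (z i).1 (z k).1‖} with hC
  set I : Config (N + 1) (Fin 3) T3 → ℝ≥0∞ := fun z => ∫⁻ ω : Metric.sphere (0 : V3) 1,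
    ENNReal.ofReal (ε ^ 2 * ⟪((ω : V3)), (z i).2 - (z j).2⟫_ℝ) * f (contactInsert ε i j (ω : V3) z) i j
      ∂(volume : Measure V3).toSphere with hI
  set H : Config (N + 1) (Fin 3) T3 → ℝ≥0∞ := fun z =>
    ENNReal.ofReal (Zc⁻¹ * Di.indicator M z) * I z with hH
  -- signs
  have hf₀nn : ∀ y, 0 ≤ f₀ y := fun y =>
    localGibbsProfile_nonneg (a₀ := fun _ => 1) (u₀ := fun _ => 0) (θ₀ := fun _ => θ)
      (fun _ => zero_le_one) (fun _ => hθ.le) y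
  have hZc0 : 0 ≤ Zc⁻¹ := inv_nonneg.2 (canonicalPartition_nonneg _ _ _ fun y => hf₀nn y)
  have hM0 : ∀ z, 0 ≤ M z := fun z => tensorPow_nonneg (fun y => hf₀nn y) (N + 1) z
  have hρ : ∀ z, canonicalDensity (Torus.geometry (Fin 3)) ε (N + 1) f₀ z = Zc⁻¹ * D.indicator M z :=
    fun z => rfl
  -- smallness
  have hεhalf : ε < 1 / 2 := (hsDiameter_le hσ.le N).trans_lt (by linarith)
  have hsmall : (N : ℝ≥0∞) * volume (Metric.ball (0 : V3) ε) ≤ 2⁻¹ :=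
    natCast_mul_volume_ball_hsDiameter_le hσ hσ4 N
  -- measurability of the dominating function
  have hsep : ∀ k l : Fin (N + 1), Measurable fun z : Config (N + 1) (Fin 3) T3 =>
      ‖(Torus.geometry (Fin 3)).sepVec (z k).1 (z l).1‖ := fun k l =>
    (Torus.measurable_geometry_sepVec.comp
      ((measurable_pi_apply k).fst.prodMk (measurable_pi_apply l).fst)).norm
  have hDim : MeasurableSet Di := by
    refine measurableSet_setOf.2 (Measurable.forall fun k => Measurable.forall fun l =>
      measurable_const.imp (measurable_const.imp (measurable_const.imp ?_)))
    exact measurableSet_setOf.1 (measurableSet_le measurable_const (hsep k l))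
  have hMm : Measurable M :=
    measurable_tensorPow (measurable_localGibbsProfile continuous_const continuous_const continuous_const)
      (N + 1)
  have hv : ∀ k : Fin (N + 1), Measurable fun p : Config (N + 1) (Fin 3) T3 × Metric.sphere (0 : V3) 1 =>
      (p.1 k).2 := fun k => measurable_snd.comp ((measurable_pi_apply k).comp measurable_fst)
  have hKf : Measurable fun p : Config (N + 1) (Fin 3) T3 × Metric.sphere (0 : V3) 1 =>
      ENNReal.ofReal (ε ^ 2 * ⟪((p.2 : V3)), (p.1 i).2 - (p.1 j).2⟫_ℝ) *
        f (contactInsert ε i j (p.2 : V3) p.1) i j :=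
    (measurable_const.mul ((measurable_subtype_coe.comp measurable_snd).inner
      ((hv i).sub (hv j)))).ennreal_ofReal.mul ((hf i j).comp (measurable_contactInsert_prod ε i j))
  have hIm : Measurable I := hKf.lintegral_prod_right'
  have hHm : Measurable H := (measurable_const.mul (hMm.indicator hDim)).ennreal_ofReal.mul hIm
  -- the dominating function does not depend on the position of particle `i`
  have hHi : ∀ z q, H (Function.update z i (q, (z i).2)) = H z := by
    intro z q
    have hk : ∀ k, k ≠ i → Function.update z i (q, (z i).2) k = z k := fun k hk =>
      Function.update_of_ne hk _ _
    have hvel : ∀ k, (Function.update z i (q, (z i).2) k).2 = (z k).2 := by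
      intro k
      by_cases hki : k = i
      · rw [hki, Function.update_self]
      · rw [hk k hki]
    have hmem : Function.update z i (q, (z i).2) ∈ Di ↔ z ∈ Di := by
      simp only [hDi, mem_setOf_eq]
      refine forall_congr' fun k => forall_congr' fun l => imp_congr_right fun _ =>
        imp_congr_right fun hki => imp_congr_right fun hli => ?_
      rw [hk k hki, hk l hli]
    have hind : Di.indicator M (Function.update z i (q, (z i).2)) = Di.indicator M z := by
      by_cases hz : z ∈ Di
      · rw [indicator_of_mem hz, indicator_of_mem (hmem.2 hz)]
        exact tensorPow_rung0_eq_of_vel_eq θ hvel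
      · rw [indicator_of_notMem hz, indicator_of_notMem (fun h => hz (hmem.1 h))]
    have hci : ∀ ω : V3, contactInsert ε i j ω (Function.update z i (q, (z i).2)) =
        contactInsert ε i j ω z := by
      intro ω
      simp only [contactInsert, Function.update_idem, Function.update_self,
        Function.update_of_ne (Ne.symm hij)]
    simp only [hH, hI, hind, hci, hvel]
  -- assembly
  refine le_trans (lintegral_mono fun z => ?_)
    ((lintegral_le_two_mul_lintegral_indicator_clear i hεhalf hsmall hHm hHi).trans
      (mul_le_mul' le_rfl (lintegral_mono fun z => ?_)))
  · -- domination of the flux integrand, integrated over the direction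
    show _ ≤ ENNReal.ofReal (Zc⁻¹ * Di.indicator M z) * I z
    simp only [hI]
    rw [← lintegral_const_mul' _ _ ENNReal.ofReal_ne_top]
    exact lintegral_mono fun ω => fluxIntegrand_le hθ ε f i j (ω : V3) z _
  · -- re-inserting the constraints of particle `i` inside the canonical density
    show C.indicator H z ≤ ENNReal.ofReal (canonicalDensity (Torus.geometry (Fin 3)) ε (N + 1) f₀ z) * I z
    by_cases hzC : z ∈ C
    · rw [indicator_of_mem hzC, hρ z]
      show ENNReal.ofReal (Zc⁻¹ * Di.indicator M z) * I z ≤ ENNReal.ofReal (Zc⁻¹ * D.indicator M z) * I z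
      refine mul_le_mul' (ENNReal.ofReal_le_ofReal (mul_le_mul_of_nonneg_left ?_ hZc0)) le_rfl
      by_cases hzDi : z ∈ Di
      · have hzD : z ∈ D := by
          intro k l hkl
          by_cases hki : k = i
          · rw [hki] at hkl ⊢
            exact hzC l (Ne.symm hkl)
          · by_cases hli : l = i
            · rw [hli, Torus.norm_geometry_sepVec, Torus.euclidDist_comm, ← Torus.norm_geometry_sepVec]
              exact hzC k hki
            · exact hzDi k l hkl hki hli
        rw [indicator_of_mem hzDi, indicator_of_mem hzD]
      · rw [indicator_of_notMem hzDi]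
        exact indicator_nonneg (fun y _ => hM0 y) z
    · rw [indicator_of_notMem hzC]
      exact zero_le

/-- **Registered stub `stub_fluxLeGibbs` (F1 of P4, line `KineticSlabSketch` of crux
`JParityClosure.OddContactSymmetry`).** The Gibbs-weighted outgoing contact flux of a measurable mark
`f ≥ 0` is at most twice the local-Gibbs expectation of the insertion integrand, at rung 0 and reduced
density `σ ≤ 1/4`: termwise in the ordered pair (`fluxTerm_le`). [folklore] -/
theorem stub_fluxLeGibbs :
    ∀ {σ : ℝ} (_hσ : 0 < σ) (_hσ4 : σ ≤ 1 / 4) {θ : ℝ} (_hθ : 0 < θ) (N : ℕ)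
    (Φ : HardSphereFlow (Torus.geometry (Fin 3)) (hsDiameter σ N) (N + 1))
    {f : Config (N + 1) (Fin 3) T3 → Fin (N + 1) → Fin (N + 1) → ℝ≥0∞} (_hf : ∀ i j, Measurable fun w => f w i j),
    outgoingCollisionFlux (hsDiameter σ N) (N + 1)
        (fun w i j => ENNReal.ofReal (canonicalDensity (Torus.geometry (Fin 3)) (hsDiameter σ N) (N + 1)
          (localGibbsProfile (fun _ => 1) (fun _ => 0) (fun _ => θ)) w) * f w i j) ≤
      2 * ∑ i : Fin (N + 1), ∑ j : Fin (N + 1), if i = j then 0 else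
        ∫⁻ z, ∫⁻ ω : Metric.sphere (0 : V3) 1,
            ENNReal.ofReal (hsDiameter σ N ^ 2 * ⟪((ω : V3)), (z i).2 - (z j).2⟫_ℝ) *
              f (contactInsert (hsDiameter σ N) i j (ω : V3) z) i j
          ∂(volume : Measure V3).toSphere
        ∂(localGibbsLaw σ (fun _ => 1) (fun _ => 0) (fun _ => θ) N Φ) := by
  intro σ hσ hσ4 θ hθ N Φ f hf
  have hcard : Fintype.card (Fin 3) - 1 = 2 := by simp
  rw [localGibbsLaw_eq]
  unfold outgoingCollisionFlux
  simp only [hcard]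
  rw [Finset.mul_sum]
  refine Finset.sum_le_sum fun i _ => ?_
  rw [Finset.mul_sum]
  refine Finset.sum_le_sum fun j _ => ?_
  split_ifs with hij
  · simp
  · exact fluxTerm_le hσ hσ4 hθ N hf hij

end Summit.AtomisticToContinuum.HydrodynamicLimit.Theorems.OddContactSymmetryKineticSlab

end
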